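import Mathlib
import Literature.RingTheory.CohomologyAnnihilator.BirationalTransfer
import HarnessLib

/-!
# Lift transfer of stable annihilation (the `2-cluster-tilting` lower-bound step)

Crux `HomologicalConductor.Persistence` (stmt-ResolutionOfSingularities-16484), chain W4.4b,
res-L1-w44b-stub-1 (g2), report `L/res-L1-w44b-stub-1/SIGMA5.md` §0.1 / §1.
`[OURS · L1 w44b]` — elementary linear algebra about stable annihilation; NOT a statement of the
manuscript under review; AI-drafted (weaker than expert review).

Setting: a presentation `P₁ —ι→ P₀ —π→ X` with `π` surjective (for instance the
`add S`-approximation `0 → C₁ → C₀ → X → 0` of a maximal Cohen–Macaulay module over an isolated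
Gorenstein quotient threefold singularity, Iyama's 2-cluster-tilting sequence). If

* `x • 1_X` LIFTS along `π` (there is `g : X → P₀` with `π ∘ g = x • id`; over a Gorenstein ring this
  holds as soon as `x` stably annihilates `P₁`, because the obstruction lives in
  `Ext¹(X, P₁) = Hom̲(ΩX, P₁)`), and
* `y • 1_{P₀}` factors through a finite free module (`β ∘ α = y • id` through `Fin s → C`),

then `(y * x) • 1_X` factors through the same free module: `(π β) (α g) = π (y • g) = (y x) • id`.
Compared with `PersistenceTwoStepTransfer.exists_comp_eq_smul_id_of_twoStep` (p488064) the
secondary-obstruction hypothesis («every map `P₁ → Cᵗ` extends along `ι`») is replaced by the lift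
hypothesis on `x`, and no exactness at `P₀` is needed. This is the mechanism behind the lower bound
`ann̲(C₀) · ann̲(C₁) ⊆ ann̲(X)`, hence `τ_all² ⊆ ca(V)`, of SIGMA5 §0.1. The `Ext` form uses the
tree lemma `smul_ext_eq_zero_of_linearMap_comp_eq_smul_id`.
-/

-- single-problem summit: the doubled namespace component is forced
set_option linter.dupNamespace false

noncomputable section

open CategoryTheory CategoryTheory.Abelian

universe u

namespace Summit.ResolutionOfSingularities.ResolutionOfSingularities.Theorems.HomologicalConductor.PersistenceLiftTransfer

open Literature.RingTheory.CohomologyAnnihilator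

variable {C : Type u} [CommRing C]

/-- **Lift transfer.** If `π : P₀ → X` is `C`-linear, `x • 1_X` lifts along `π`
(`π ∘ g = x • id`) and `y • 1_{P₀}` factors through `Fin s → C` (`β ∘ α = y • id`), then
`(y * x) • 1_X` factors through `Fin s → C`, namely as `(π ∘ β) ∘ (α ∘ g)`. [folklore] -/
theorem exists_comp_eq_smul_id_of_lift {X P₀ : Type*} [AddCommGroup X] [Module C X]
    [AddCommGroup P₀] [Module C P₀] (π : P₀ →ₗ[C] X) {x y : C} (g : X →ₗ[C] P₀)
    (hg : π ∘ₗ g = x • LinearMap.id) {s : ℕ} (α : P₀ →ₗ[C] (Fin s → C))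
    (β : (Fin s → C) →ₗ[C] P₀) (hαβ : β ∘ₗ α = y • LinearMap.id) :
    ∃ (ιX : X →ₗ[C] (Fin s → C)) (πX : (Fin s → C) →ₗ[C] X),
      πX ∘ₗ ιX = (y * x) • LinearMap.id := by
  refine ⟨α ∘ₗ g, π ∘ₗ β, LinearMap.ext fun v => ?_⟩
  have h1 : β (α (g v)) = y • g v := LinearMap.congr_fun hαβ (g v)
  have h2 : π (g v) = x • v := LinearMap.congr_fun hg v
  simp only [LinearMap.comp_apply, h1, map_smul, h2, LinearMap.smul_apply, LinearMap.id_apply,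
    mul_smul]

/-- **Lift transfer, symmetric bookkeeping form.** With `π : P₀ → X` surjective-or-not, if every
element of a set `I` lifts (`∀ x ∈ I, ∃ g, π ∘ g = x • id`) and every element of a set `J` stably
annihilates `P₀` through some finite free module, then every product `y * x` (`y ∈ J`, `x ∈ I`)
stably annihilates `X` through a finite free module. [folklore] -/
theorem exists_comp_eq_smul_id_of_mem_mul {X P₀ : Type*} [AddCommGroup X] [Module C X]
    [AddCommGroup P₀] [Module C P₀] (π : P₀ →ₗ[C] X) {I J : Set C}
    (hI : ∀ x ∈ I, ∃ g : X →ₗ[C] P₀, π ∘ₗ g = x • LinearMap.id)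
    (hJ : ∀ y ∈ J, ∃ (s : ℕ) (α : P₀ →ₗ[C] (Fin s → C)) (β : (Fin s → C) →ₗ[C] P₀),
      β ∘ₗ α = y • LinearMap.id)
    {x y : C} (hx : x ∈ I) (hy : y ∈ J) :
    ∃ (s : ℕ) (ιX : X →ₗ[C] (Fin s → C)) (πX : (Fin s → C) →ₗ[C] X),
      πX ∘ₗ ιX = (y * x) • LinearMap.id := by
  obtain ⟨g, hg⟩ := hI x hx
  obtain ⟨s, α, β, hαβ⟩ := hJ y hy
  obtain ⟨ιX, πX, h⟩ := exists_comp_eq_smul_id_of_lift π g hg α β hαβ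
  exact ⟨s, ιX, πX, h⟩

/-- **Lift transfer, `Ext` form**: in the situation of `exists_comp_eq_smul_id_of_lift`, `y * x`
kills `Extⁱ_C(X, N)` for every `C`-module `N` and every `i ≥ 1`. [folklore] -/
theorem smul_ext_eq_zero_of_lift {X P₀ : Type u} [AddCommGroup X] [Module C X]
    [AddCommGroup P₀] [Module C P₀] (π : P₀ →ₗ[C] X) {x y : C} (g : X →ₗ[C] P₀)
    (hg : π ∘ₗ g = x • LinearMap.id) {s : ℕ} (α : P₀ →ₗ[C] (Fin s → C))
    (β : (Fin s → C) →ₗ[C] P₀) (hαβ : β ∘ₗ α = y • LinearMap.id)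
    (N : ModuleCat.{u} C) {i : ℕ} (hi : 1 ≤ i) (e : Ext.{u} (ModuleCat.of C X) N i) :
    (y * x) • e = 0 := by
  obtain ⟨ιX, πX, h⟩ := exists_comp_eq_smul_id_of_lift π g hg α β hαβ
  exact smul_ext_eq_zero_of_linearMap_comp_eq_smul_id ιX πX h N hi e

end Summit.ResolutionOfSingularities.ResolutionOfSingularities.Theorems.HomologicalConductor.PersistenceLiftTransfer

end
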